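import Summits.QuantumFields.YangMills.Theorems.UnitScaleTiltProp7CentreHarmonicInterpKernel
import Literature.MathematicalPhysics.QuantumFieldTheory.Balaban1983to89.B10StarCount
import HarnessLib

/-!
# Route `UnitScaleTilt`, crux K1 «MinimiserStabilityRegPr» (stmt-QuantumFields-19200), route-R E′ path (α′), sup row (hK) of
# ✓ `…CentreHarmonicInterpKernel.norm_grad_interp_error_le` — (D2′) AGMON, FILE 1∕3: LETTERS.  The lattice Leibniz rule
# `Δ(we) = wΔe − c²Σ_μ[δ⁺w·δ⁺e + δ⁻w·δ⁻e + (δ²w)·e]` and the `ℓ²` COMMUTATOR BOUND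
# `Σ_x (θ[Δ,w]e)² ≤ 10d·α²c²·Σ_b(ω(b₋)∂e(b))² + 3d²·β²c⁴·Σ_x(ωe)²` against a reference weight `ω`

Cell `ym3-torus`, D-0154 (3c) width seat `ym-routeR-w6` (gen 5), on ★routeR-w3 g5's «routeR-w6: GO (D2′)» 2026-08-28T18:22:37Z (interface (1)–(4) of
that line); `--supports stmt-QuantumFields-19200`, count-neutral.  THEOREMS ONLY (0 `def`, 0 `sorry`).  YM₃ on T³ is a ladder rung (R3), not the
Clay problem; nothing here claims the stub, the crux, d = 4 or the gap.

THE POINT (LOCATE `ym-routeR-w3/LOCATE-HINTERP-routeRw3g5.md` §§2–3; this seat's sign-in 18:22:07Z).  The decay input (D2) of the kernel row (hK) —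
exponential screening at scale ℓ of the pinned biharmonic least-squares problem `e = argmin{Σ(Δw − h)² : w|_C = 0}` — is proved in ENERGY form
(Agmon's weighted estimate), not by Combes–Thomas operator theory (which on the pinned `Δ²`, gap `~ℓ⁻⁴` against bandwidth `O(1)`, yields decay
length `ℓ⁴`, not ℓ) and not by Fourier.  The form-relative perturbation argument needs the conjugation weight `ω = e^{κρ∕ℓ}` to be SMOOTH AT
SCALE ℓ: first differences `|ω(x±e_μ) − ω(x)| ≤ a·ω(x)` (`a ~ κ∕ℓ`) AND second differences `|ω(x+e_μ) + ω(x−e_μ) − 2ω(x)| ≤ b·ω(x)` (`b ~ κ∕ℓ²`,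
e.g. `ρ` = window-averaged torus distance).  This file supplies the letters: the commutator `[Δ, w]` of the lattice Laplacian with a multiplier is a
FIRST-ORDER operator in `e` whose coefficients are first∕second differences of `w` (`laplace_mul`), whence its weighted `ℓ²` size is
`O(a)·‖ω∂e‖ + O(b)·‖ωe‖` (`sum_sq_weighted_comm_le`, read through a test weight `θ` so that both `w = ω` (θ = 1) and `w = ω²` (θ = ω⁻¹) are covered).

WHAT IS PROVED (ns `…Theorems.Prop7PinnedBiharmonicAgmonLetters`; any `P`, level `j`, REAL site fields — matrix∕𝔰𝔲 fields by components as in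
✓ `Prop7PinnedFlatCoercivity`; `LatticeFieldCalculus` letters `grad c`, `laplace c`, lattice factor `c`; Green's identity REUSED from ✓ `Prop7PinnedHodgeSplit`).
* §0 `grad_mk`, `grad_mk_unshift`, `sum_bond_tgt` (`Σ_b f(b₊) = d·Σ_x f(x)`).
* §1 ★ `laplace_mul` (lattice Leibniz for `Δ`), `grad_mul'` (`∂(we)(b) = w(b₋)∂e(b) + c(w(b₊) − w(b₋))e(b₊)`).
* §2 `abs_weighted_comm_le` ∕ `sq_weighted_comm_le` (pointwise), `weight_shift_le` ∕ `weight_unshift_le` (`ω(x±e_μ) ≤ (3∕2)ω(x)` for `a ≤ 1∕2`),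
  `sum_bond_sq_eq` ∕ `sum_bond_tgt_sq_eq` ∕ `sum_bond_tgt_sq_le` (`Σ_b(ω(b₊)∂e)² ≤ (9∕4)Σ_b(ω(b₋)∂e)²`), ★★ `sum_sq_weighted_comm_le`.
HONEST SCOPE.  Elementary lattice calculus on the torus; no analytic input.  Files 2∕3 (`…AgmonInterp`, `…AgmonDecay`) carry the weighted
interpolation inequality and the Agmon estimate; (D1-glob) (routeR-w2 g5's (D1-cell) summed) stays DISPLAYED there; the pointwise near-field
inputs of (hK) (`|∇G₁| ≲ r⁻²`, `|∇G₂| = O(1)`, `|∇²G₂| ≲ r⁻¹` — in print for the clamped box: [MullerSchweiger2019] Thm 1.1 (n = 3) + Rem. 8.4)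
and the assembly (A) stay with the routeR-w3 lineage.

References: T. Bałaban, CMP 95 (1984) 17–40 [Balaban1984PropagatorsI] ((1.21) p.21); CMP 96 (1984) 223–250 [Balaban1984PropagatorsII] ((1.9) p.226);
S. Agmon, *Lectures on exponential decay of solutions of second-order elliptic equations*, Princeton Math. Notes 29 (1982) (method);
S. Müller, F. Schweiger, Vietnam J. Math. 47 (2019) 133–181, arXiv:1712.02587 [MullerSchweiger2019] (near-field inputs, not used here).
-/

set_option autoImplicit false

noncomputable section

open scoped BigOperators

namespace Summit.QuantumFields.YangMills.Theorems.Prop7PinnedBiharmonicAgmonLetters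

open Literature.MathematicalPhysics.QuantumFieldTheory.Balaban1983to89
open Finset LatticeFieldCalculus
open B10StarCount (sum_pbond shift_unshift unshift_shift)
open Summit.QuantumFields.YangMills.Theorems.Prop7CentreHarmonicInterpKernel (sum_comp_shift sum_comp_unshift' laplace_sub')
open Summit.QuantumFields.YangMills.Theorems.Prop7PinnedHodgeSplit (sum_mul_laplace_eq_sum_grad_mul sum_mul_laplace_comm)

variable {P : Params} {j : ℕ}

/-! ## §0 Torus bookkeeping -/

/-- `∂e⟨x, μ⟩ = c·(e(x+e_μ) − e(x))`. [folklore] -/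
theorem grad_mk (c : ℝ) (e : SiteField P j ℝ) (x : Site P j) (μ : Fin P.d) :
    grad c e ⟨x, μ⟩ = c * (e (x.shift μ) - e x) := by
  simp [grad, PBond.tgt, smul_eq_mul]

/-- `∂e⟨x − e_μ, μ⟩ = c·(e(x) − e(x − e_μ))`. [folklore] -/
theorem grad_mk_unshift (c : ℝ) (e : SiteField P j ℝ) (x : Site P j) (μ : Fin P.d) :
    grad c e ⟨x.unshift μ, μ⟩ = c * (e x - e (x.unshift μ)) := by
  simp [grad, PBond.tgt, smul_eq_mul]

/-- a bond sum of a function of (source, target-value) reindexed: `Σ_b F(b₊) = d·Σ_x F(x)`-type identity,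
`Σ_b f (b.tgt) = Σ_μ Σ_x f (x.shift μ) = d · Σ_x f x`. [folklore] -/
theorem sum_bond_tgt (f : Site P j → ℝ) : ∑ b : PBond P j, f b.tgt = (P.d : ℝ) * ∑ x : Site P j, f x := by
  rw [sum_pbond, Finset.sum_comm]
  simp only [PBond.tgt]
  rw [Finset.sum_congr rfl fun μ _ => sum_comp_shift μ f, Finset.sum_const, Finset.card_univ, Fintype.card_fin,
    nsmul_eq_mul]

/-! ## §1 Green's identity and the lattice Leibniz rule -/

/-- **LATTICE LEIBNIZ RULE FOR `Δ`** (the commutator `[Δ, ω]` in first/second-difference form): for site functions `w, e`,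
`Δ(w·e)(x) = w(x)(Δe)(x) − c²Σ_μ [ (w(x+e_μ) − w(x))(e(x+e_μ) − e(x)) + (w(x−e_μ) − w(x))(e(x−e_μ) − e(x)) + (w(x+e_μ) + w(x−e_μ) − 2w(x))·e(x) ]`.
[folklore] -/
theorem laplace_mul (c : ℝ) (w e : SiteField P j ℝ) (x : Site P j) :
    laplace c (fun y => w y * e y) x = w x * laplace c e x
      - c ^ 2 * ∑ μ : Fin P.d, ((w (x.shift μ) - w x) * (e (x.shift μ) - e x)
          + (w (x.unshift μ) - w x) * (e (x.unshift μ) - e x)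
          + (w (x.shift μ) + w (x.unshift μ) - 2 * w x) * e x) := by
  simp only [laplace, smul_eq_mul, Finset.mul_sum, ← Finset.sum_sub_distrib]
  exact Finset.sum_congr rfl fun μ _ => by ring

/-- **LEIBNIZ RULE FOR `∂`**: `∂(w·e)(b) = w(b₋)·(∂e)(b) + c·(w(b₊) − w(b₋))·e(b₊)`. [folklore] -/
theorem grad_mul' (c : ℝ) (w e : SiteField P j ℝ) (b : PBond P j) :
    grad c (fun y => w y * e y) b = w b.src * grad c e b + c * (w b.tgt - w b.src) * e b.tgt := by
  simp only [grad, smul_eq_mul]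
  ring

/-! ## §2 Pointwise and `ℓ²` bounds for the commutator `[Δ, w]` against a reference weight `ω` -/

/-- `c²·|e(x+e_μ) − e(x)| = |c|·|∂e⟨x,μ⟩|`. [folklore] -/
theorem sq_mul_abs_sub_shift (c : ℝ) (e : SiteField P j ℝ) (x : Site P j) (μ : Fin P.d) :
    c ^ 2 * |e (x.shift μ) - e x| = |c| * |grad c e ⟨x, μ⟩| := by
  rw [grad_mk, abs_mul, ← mul_assoc, abs_mul_abs_self, sq]

/-- `c²·|e(x−e_μ) − e(x)| = |c|·|∂e⟨x−e_μ,μ⟩|`. [folklore] -/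
theorem sq_mul_abs_sub_unshift (c : ℝ) (e : SiteField P j ℝ) (x : Site P j) (μ : Fin P.d) :
    c ^ 2 * |e (x.unshift μ) - e x| = |c| * |grad c e ⟨x.unshift μ, μ⟩| := by
  rw [grad_mk_unshift, abs_mul, ← mul_assoc, abs_mul_abs_self, sq, abs_sub_comm]

/-- **POINTWISE COMMUTATOR BOUND.**  If a multiplier `w` has first differences `θ·|w(x±e_μ) − w(x)| ≤ α·ω(x)` and second differences
`θ·|w(x+e_μ) + w(x−e_μ) − 2w(x)| ≤ β·ω(x)` against the reference weight `ω` (read through a nonnegative test weight `θ`), then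
`θ(x)·|Δ(we)(x) − w(x)(Δe)(x)| ≤ Σ_μ ( α|c|·ω(x)|∂e⟨x,μ⟩| + α|c|·ω(x)|∂e⟨x−e_μ,μ⟩| + βc²·ω(x)|e(x)| )`. [folklore] -/
theorem abs_weighted_comm_le (c : ℝ) (ω w θ e : SiteField P j ℝ) {α β : ℝ} (hθ : ∀ x, 0 ≤ θ x)
    (hw₁ : ∀ x μ, θ x * |w (x.shift μ) - w x| ≤ α * ω x ∧ θ x * |w (x.unshift μ) - w x| ≤ α * ω x)
    (hw₂ : ∀ x μ, θ x * |w (x.shift μ) + w (x.unshift μ) - 2 * w x| ≤ β * ω x) (x : Site P j) :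
    |θ x * (laplace c (fun y => w y * e y) x - w x * laplace c e x)|
      ≤ ∑ μ : Fin P.d, (α * |c| * (ω x * |grad c e ⟨x, μ⟩|) + α * |c| * (ω x * |grad c e ⟨x.unshift μ, μ⟩|)
          + β * c ^ 2 * (ω x * |e x|)) := by
  rw [laplace_mul]
  have hθx := hθ x
  -- the three-term bracket in direction `μ`
  set F : Fin P.d → ℝ := fun μ => (w (x.shift μ) - w x) * (e (x.shift μ) - e x)
      + (w (x.unshift μ) - w x) * (e (x.unshift μ) - e x) + (w (x.shift μ) + w (x.unshift μ) - 2 * w x) * e x with hF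
  have e1 : θ x * (w x * laplace c e x - c ^ 2 * ∑ μ : Fin P.d, F μ - w x * laplace c e x)
      = -(c ^ 2 * ∑ μ : Fin P.d, θ x * F μ) := by
    rw [← Finset.mul_sum]; ring
  rw [e1, abs_neg, abs_mul, abs_of_nonneg (sq_nonneg c)]
  -- per direction
  have hdir : ∀ μ : Fin P.d, c ^ 2 * |θ x * F μ| ≤ α * |c| * (ω x * |grad c e ⟨x, μ⟩|)
      + α * |c| * (ω x * |grad c e ⟨x.unshift μ, μ⟩|) + β * c ^ 2 * (ω x * |e x|) := by
    intro μ
    have h1 := (hw₁ x μ).1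
    have h2 := (hw₁ x μ).2
    have h3 := hw₂ x μ
    have hb : θ x * |F μ| ≤ α * ω x * |e (x.shift μ) - e x| + α * ω x * |e (x.unshift μ) - e x| + β * ω x * |e x| := by
      calc θ x * |F μ|
          ≤ θ x * (|(w (x.shift μ) - w x) * (e (x.shift μ) - e x)| + |(w (x.unshift μ) - w x) * (e (x.unshift μ) - e x)|
            + |(w (x.shift μ) + w (x.unshift μ) - 2 * w x) * e x|) := by
            apply mul_le_mul_of_nonneg_left _ hθx
            exact abs_add_three _ _ _
        _ = θ x * |w (x.shift μ) - w x| * |e (x.shift μ) - e x| + θ x * |w (x.unshift μ) - w x| * |e (x.unshift μ) - e x|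
            + θ x * |w (x.shift μ) + w (x.unshift μ) - 2 * w x| * |e x| := by
            rw [abs_mul, abs_mul, abs_mul]; ring
        _ ≤ α * ω x * |e (x.shift μ) - e x| + α * ω x * |e (x.unshift μ) - e x| + β * ω x * |e x| := by
            gcongr
    rw [abs_mul, abs_of_nonneg hθx]
    calc c ^ 2 * (θ x * |F μ|)
        ≤ c ^ 2 * (α * ω x * |e (x.shift μ) - e x| + α * ω x * |e (x.unshift μ) - e x| + β * ω x * |e x|) :=
          mul_le_mul_of_nonneg_left hb (sq_nonneg c)
      _ = α * ω x * (c ^ 2 * |e (x.shift μ) - e x|) + α * ω x * (c ^ 2 * |e (x.unshift μ) - e x|)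
          + β * c ^ 2 * (ω x * |e x|) := by ring
      _ = α * |c| * (ω x * |grad c e ⟨x, μ⟩|) + α * |c| * (ω x * |grad c e ⟨x.unshift μ, μ⟩|)
          + β * c ^ 2 * (ω x * |e x|) := by
          rw [sq_mul_abs_sub_shift, sq_mul_abs_sub_unshift]; ring
  calc c ^ 2 * |∑ μ : Fin P.d, θ x * F μ| ≤ c ^ 2 * ∑ μ : Fin P.d, |θ x * F μ| :=
        mul_le_mul_of_nonneg_left (Finset.abs_sum_le_sum_abs _ _) (sq_nonneg c)
    _ = ∑ μ : Fin P.d, c ^ 2 * |θ x * F μ| := Finset.mul_sum _ _ _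
    _ ≤ _ := Finset.sum_le_sum fun μ _ => hdir μ

/-- **SQUARED POINTWISE COMMUTATOR BOUND**: under the rows of `abs_weighted_comm_le`,
`(θ(x)(Δ(we) − wΔe)(x))² ≤ 3d·Σ_μ ( α²c²ω(x)²(∂e⟨x,μ⟩)² + α²c²ω(x)²(∂e⟨x−e_μ,μ⟩)² + β²c⁴ω(x)²e(x)² )`. [folklore] -/
theorem sq_weighted_comm_le (c : ℝ) (ω w θ e : SiteField P j ℝ) {α β : ℝ} (hθ : ∀ x, 0 ≤ θ x)
    (hw₁ : ∀ x μ, θ x * |w (x.shift μ) - w x| ≤ α * ω x ∧ θ x * |w (x.unshift μ) - w x| ≤ α * ω x)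
    (hw₂ : ∀ x μ, θ x * |w (x.shift μ) + w (x.unshift μ) - 2 * w x| ≤ β * ω x) (x : Site P j) :
    (θ x * (laplace c (fun y => w y * e y) x - w x * laplace c e x)) ^ 2
      ≤ 3 * P.d * ∑ μ : Fin P.d, (α ^ 2 * c ^ 2 * (ω x * grad c e ⟨x, μ⟩) ^ 2
          + α ^ 2 * c ^ 2 * (ω x * grad c e ⟨x.unshift μ, μ⟩) ^ 2 + β ^ 2 * c ^ 4 * (ω x * e x) ^ 2) := by
  have h := abs_weighted_comm_le c ω w θ e hθ hw₁ hw₂ x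
  set T := ∑ μ : Fin P.d, (α * |c| * (ω x * |grad c e ⟨x, μ⟩|) + α * |c| * (ω x * |grad c e ⟨x.unshift μ, μ⟩|)
          + β * c ^ 2 * (ω x * |e x|)) with hT
  have h1 : (θ x * (laplace c (fun y => w y * e y) x - w x * laplace c e x)) ^ 2 ≤ T ^ 2 := by
    rw [← sq_abs]
    exact pow_le_pow_left₀ (abs_nonneg _) h 2
  have h2 : T ^ 2 ≤ (Finset.univ : Finset (Fin P.d)).card * ∑ μ : Fin P.d, (α * |c| * (ω x * |grad c e ⟨x, μ⟩|)
      + α * |c| * (ω x * |grad c e ⟨x.unshift μ, μ⟩|) + β * c ^ 2 * (ω x * |e x|)) ^ 2 :=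
    sq_sum_le_card_mul_sum_sq
  rw [Finset.card_univ, Fintype.card_fin] at h2
  refine h1.trans (h2.trans ?_)
  have hd : (0 : ℝ) ≤ P.d := Nat.cast_nonneg _
  have hμ : ∀ μ : Fin P.d, (α * |c| * (ω x * |grad c e ⟨x, μ⟩|) + α * |c| * (ω x * |grad c e ⟨x.unshift μ, μ⟩|)
      + β * c ^ 2 * (ω x * |e x|)) ^ 2
      ≤ 3 * (α ^ 2 * c ^ 2 * (ω x * grad c e ⟨x, μ⟩) ^ 2 + α ^ 2 * c ^ 2 * (ω x * grad c e ⟨x.unshift μ, μ⟩) ^ 2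
        + β ^ 2 * c ^ 4 * (ω x * e x) ^ 2) := by
    intro μ
    have h3 : ∀ p q r : ℝ, (p + q + r) ^ 2 ≤ 3 * (p ^ 2 + q ^ 2 + r ^ 2) := fun p q r => by
      nlinarith [sq_nonneg (p - q), sq_nonneg (q - r), sq_nonneg (p - r)]
    have h3 := h3 (α * |c| * (ω x * |grad c e ⟨x, μ⟩|)) (α * |c| * (ω x * |grad c e ⟨x.unshift μ, μ⟩|))
      (β * c ^ 2 * (ω x * |e x|))
    have e3 : (α * |c| * (ω x * |grad c e ⟨x, μ⟩|)) ^ 2 + (α * |c| * (ω x * |grad c e ⟨x.unshift μ, μ⟩|)) ^ 2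
        + (β * c ^ 2 * (ω x * |e x|)) ^ 2
        = α ^ 2 * c ^ 2 * (ω x * grad c e ⟨x, μ⟩) ^ 2 + α ^ 2 * c ^ 2 * (ω x * grad c e ⟨x.unshift μ, μ⟩) ^ 2
          + β ^ 2 * c ^ 4 * (ω x * e x) ^ 2 := by
      simp only [mul_pow, sq_abs]; ring
    rw [e3] at h3
    exact h3
  calc (P.d : ℝ) * ∑ μ : Fin P.d, (α * |c| * (ω x * |grad c e ⟨x, μ⟩|) + α * |c| * (ω x * |grad c e ⟨x.unshift μ, μ⟩|)
        + β * c ^ 2 * (ω x * |e x|)) ^ 2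
      ≤ (P.d : ℝ) * ∑ μ : Fin P.d, 3 * (α ^ 2 * c ^ 2 * (ω x * grad c e ⟨x, μ⟩) ^ 2
        + α ^ 2 * c ^ 2 * (ω x * grad c e ⟨x.unshift μ, μ⟩) ^ 2 + β ^ 2 * c ^ 4 * (ω x * e x) ^ 2) :=
        mul_le_mul_of_nonneg_left (Finset.sum_le_sum fun μ _ => hμ μ) hd
    _ = 3 * P.d * ∑ μ : Fin P.d, (α ^ 2 * c ^ 2 * (ω x * grad c e ⟨x, μ⟩) ^ 2
        + α ^ 2 * c ^ 2 * (ω x * grad c e ⟨x.unshift μ, μ⟩) ^ 2 + β ^ 2 * c ^ 4 * (ω x * e x) ^ 2) := by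
        rw [← Finset.mul_sum]; ring

/-- from the first-difference row: `ω(x + e_μ) ≤ (3/2)·ω(x)` when `a ≤ 1/2`. [folklore] -/
theorem weight_shift_le (ω : SiteField P j ℝ) {a : ℝ} (ha : a ≤ 1 / 2) (hω₀ : ∀ x, 0 < ω x)
    (hω₁ : ∀ x μ, |ω (x.shift μ) - ω x| ≤ a * ω x ∧ |ω (x.unshift μ) - ω x| ≤ a * ω x) (x : Site P j) (μ : Fin P.d) :
    ω (x.shift μ) ≤ 3 / 2 * ω x := by
  have h := (abs_le.mp (hω₁ x μ).1).2
  have := hω₀ x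
  nlinarith

/-- from the first-difference row: `ω(x − e_μ) ≤ (3/2)·ω(x)` when `a ≤ 1/2`. [folklore] -/
theorem weight_unshift_le (ω : SiteField P j ℝ) {a : ℝ} (ha : a ≤ 1 / 2) (hω₀ : ∀ x, 0 < ω x)
    (hω₁ : ∀ x μ, |ω (x.shift μ) - ω x| ≤ a * ω x ∧ |ω (x.unshift μ) - ω x| ≤ a * ω x) (x : Site P j) (μ : Fin P.d) :
    ω (x.unshift μ) ≤ 3 / 2 * ω x := by
  have h := (abs_le.mp (hω₁ x μ).2).2
  have := hω₀ x
  nlinarith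

/-- the source-weighted bond energy as a double sum: `Σ_b (ω(b₋)∂e(b))² = Σ_x Σ_μ (ω(x)∂e⟨x,μ⟩)²`. [folklore] -/
theorem sum_bond_sq_eq (c : ℝ) (ω e : SiteField P j ℝ) :
    ∑ b : PBond P j, (ω b.src * grad c e b) ^ 2 = ∑ x : Site P j, ∑ μ : Fin P.d, (ω x * grad c e ⟨x, μ⟩) ^ 2 :=
  sum_pbond _

/-- the target-weighted bond energy as a double sum over backward bonds: `Σ_b (ω(b₊)∂e(b))² = Σ_x Σ_μ (ω(x)∂e⟨x−e_μ,μ⟩)²`. [folklore] -/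
theorem sum_bond_tgt_sq_eq (c : ℝ) (ω e : SiteField P j ℝ) :
    ∑ b : PBond P j, (ω b.tgt * grad c e b) ^ 2 = ∑ x : Site P j, ∑ μ : Fin P.d, (ω x * grad c e ⟨x.unshift μ, μ⟩) ^ 2 := by
  rw [sum_pbond]
  conv_lhs => rw [Finset.sum_comm]
  conv_rhs => rw [Finset.sum_comm]
  refine Finset.sum_congr rfl fun μ _ => ?_
  rw [← sum_comp_unshift' μ (fun y => (ω (PBond.tgt ⟨y, μ⟩) * grad c e ⟨y, μ⟩) ^ 2)]
  refine Finset.sum_congr rfl fun x _ => ?_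
  simp only [PBond.tgt, shift_unshift]

/-- the backward-bond energy is controlled by the forward one: `Σ_b (ω(b₊)∂e(b))² ≤ (9/4)·Σ_b (ω(b₋)∂e(b))²` (`a ≤ 1/2`). [folklore] -/
theorem sum_bond_tgt_sq_le (c : ℝ) (ω e : SiteField P j ℝ) {a : ℝ} (ha : a ≤ 1 / 2) (hω₀ : ∀ x, 0 < ω x)
    (hω₁ : ∀ x μ, |ω (x.shift μ) - ω x| ≤ a * ω x ∧ |ω (x.unshift μ) - ω x| ≤ a * ω x) :
    ∑ b : PBond P j, (ω b.tgt * grad c e b) ^ 2 ≤ 9 / 4 * ∑ b : PBond P j, (ω b.src * grad c e b) ^ 2 := by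
  rw [Finset.mul_sum]
  refine Finset.sum_le_sum fun b _ => ?_
  have h1 : ω b.tgt ≤ 3 / 2 * ω b.src := weight_shift_le ω ha hω₀ hω₁ b.src b.dir
  have h2 : 0 < ω b.tgt := hω₀ _
  have h3 : ω b.tgt ^ 2 ≤ 9 / 4 * ω b.src ^ 2 := by nlinarith
  rw [mul_pow, mul_pow]
  calc ω b.tgt ^ 2 * grad c e b ^ 2 ≤ (9 / 4 * ω b.src ^ 2) * grad c e b ^ 2 :=
        mul_le_mul_of_nonneg_right h3 (sq_nonneg _)
    _ = 9 / 4 * (ω b.src ^ 2 * grad c e b ^ 2) := by ring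

/-- **`ℓ²` COMMUTATOR BOUND**: under the weight rows (`a ≤ 1/2`) and the multiplier rows of `abs_weighted_comm_le`,
`Σ_x (θ(Δ(we) − wΔe))² ≤ 10d·α²c²·Σ_b (ω(b₋)∂e(b))² + 3d²·β²c⁴·Σ_x (ω e)²`. [folklore] -/
theorem sum_sq_weighted_comm_le (c : ℝ) (ω w θ e : SiteField P j ℝ) {a α β : ℝ} (ha : a ≤ 1 / 2) (hω₀ : ∀ x, 0 < ω x)
    (hω₁ : ∀ x μ, |ω (x.shift μ) - ω x| ≤ a * ω x ∧ |ω (x.unshift μ) - ω x| ≤ a * ω x) (hθ : ∀ x, 0 ≤ θ x)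
    (hw₁ : ∀ x μ, θ x * |w (x.shift μ) - w x| ≤ α * ω x ∧ θ x * |w (x.unshift μ) - w x| ≤ α * ω x)
    (hw₂ : ∀ x μ, θ x * |w (x.shift μ) + w (x.unshift μ) - 2 * w x| ≤ β * ω x) :
    ∑ x : Site P j, (θ x * (laplace c (fun y => w y * e y) x - w x * laplace c e x)) ^ 2
      ≤ 10 * P.d * (α ^ 2 * c ^ 2) * ∑ b : PBond P j, (ω b.src * grad c e b) ^ 2
        + 3 * (P.d : ℝ) ^ 2 * (β ^ 2 * c ^ 4) * ∑ x : Site P j, (ω x * e x) ^ 2 := by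
  have hd : (0 : ℝ) ≤ P.d := Nat.cast_nonneg _
  -- sum the pointwise bound
  have h1 : ∑ x : Site P j, (θ x * (laplace c (fun y => w y * e y) x - w x * laplace c e x)) ^ 2
      ≤ ∑ x : Site P j, 3 * P.d * ∑ μ : Fin P.d, (α ^ 2 * c ^ 2 * (ω x * grad c e ⟨x, μ⟩) ^ 2
          + α ^ 2 * c ^ 2 * (ω x * grad c e ⟨x.unshift μ, μ⟩) ^ 2 + β ^ 2 * c ^ 4 * (ω x * e x) ^ 2) :=
    Finset.sum_le_sum fun x _ => sq_weighted_comm_le c ω w θ e hθ hw₁ hw₂ x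
  refine h1.trans ?_
  -- split the three sums
  have hsplit : ∑ x : Site P j, 3 * P.d * ∑ μ : Fin P.d, (α ^ 2 * c ^ 2 * (ω x * grad c e ⟨x, μ⟩) ^ 2
          + α ^ 2 * c ^ 2 * (ω x * grad c e ⟨x.unshift μ, μ⟩) ^ 2 + β ^ 2 * c ^ 4 * (ω x * e x) ^ 2)
      = 3 * P.d * ((∑ x : Site P j, ∑ μ : Fin P.d, α ^ 2 * c ^ 2 * (ω x * grad c e ⟨x, μ⟩) ^ 2)
          + (∑ x : Site P j, ∑ μ : Fin P.d, α ^ 2 * c ^ 2 * (ω x * grad c e ⟨x.unshift μ, μ⟩) ^ 2)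
          + ∑ x : Site P j, ∑ _μ : Fin P.d, β ^ 2 * c ^ 4 * (ω x * e x) ^ 2) := by
    rw [← Finset.mul_sum]
    congr 1
    simp only [Finset.sum_add_distrib]
  have hA : ∑ x : Site P j, ∑ μ : Fin P.d, α ^ 2 * c ^ 2 * (ω x * grad c e ⟨x, μ⟩) ^ 2
      = α ^ 2 * c ^ 2 * ∑ b : PBond P j, (ω b.src * grad c e b) ^ 2 := by
    rw [sum_bond_sq_eq, Finset.mul_sum]
    exact Finset.sum_congr rfl fun x _ => by rw [Finset.mul_sum]
  have hB : ∑ x : Site P j, ∑ μ : Fin P.d, α ^ 2 * c ^ 2 * (ω x * grad c e ⟨x.unshift μ, μ⟩) ^ 2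
      = α ^ 2 * c ^ 2 * ∑ b : PBond P j, (ω b.tgt * grad c e b) ^ 2 := by
    rw [sum_bond_tgt_sq_eq, Finset.mul_sum]
    exact Finset.sum_congr rfl fun x _ => by rw [Finset.mul_sum]
  have hC : ∑ x : Site P j, ∑ _μ : Fin P.d, β ^ 2 * c ^ 4 * (ω x * e x) ^ 2
      = P.d * (β ^ 2 * c ^ 4) * ∑ x : Site P j, (ω x * e x) ^ 2 := by
    rw [Finset.mul_sum]
    refine Finset.sum_congr rfl fun x _ => ?_
    rw [Finset.sum_const, Finset.card_univ, Fintype.card_fin, nsmul_eq_mul]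
    ring
  rw [hsplit, hA, hB, hC]
  have h2 := sum_bond_tgt_sq_le c ω e ha hω₀ hω₁
  have hG : 0 ≤ ∑ b : PBond P j, (ω b.src * grad c e b) ^ 2 := Finset.sum_nonneg fun _ _ => sq_nonneg _
  have hN : 0 ≤ ∑ x : Site P j, (ω x * e x) ^ 2 := Finset.sum_nonneg fun _ _ => sq_nonneg _
  have hαc : 0 ≤ α ^ 2 * c ^ 2 := by positivity
  have hβc : 0 ≤ β ^ 2 * c ^ 4 := by positivity
  have hdαc : 0 ≤ (P.d : ℝ) * (α ^ 2 * c ^ 2) := mul_nonneg hd hαc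
  nlinarith [mul_le_mul_of_nonneg_left h2 hdαc, mul_nonneg hdαc hG]

end Summit.QuantumFields.YangMills.Theorems.Prop7PinnedBiharmonicAgmonLetters

end
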